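import Mathlib
import Literature.Topology.FourManifolds.GroupTrisections

/-!
# Crux-ideate sketch — `CongruenceShadows.ShadowsStandard` (item stmt-SmoothPoincare4-14593),
# round 1, ideator 2

First lemmas of the two idea cards, typed over existing declarations only
(`Literature.Topology.FourManifolds.GroupTrisections`), plus the RESIDUE LEMMA of card
`finitary-ac-central-residue`, proved here in its discrete/finite form; plus the semisimple-level
statements of card `semisimple-venn-monodromy` and the first lemma of card `wall-witt-reducing-curves`.

* `ShadowsStandardSig`            — verbatim restatement of the crux (for reference).
* `OneSidedShadowStandard`        — card A, first lemma (finitary-AC normal form seen from H₀).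
* `OneSidedShadowStandardStrong`  — card A, the same with slot 1 fixed (needs Goeritz realisation).
* `residue_le_of_center_trivial`, `residue_eq_of_center_trivial` — card A, the residue lemma
  (PROVED): with `N, A, B ⊴ G`, `B ≤ N ⊔ A`, `N ⊓ B ≤ A` and `Z((N ⊔ A)/A) = 1`, one has `B ≤ A`.
* `LevelIntersectionRigidity`     — card A, the transferred crux C⁺ in level-wise form.
* `StablyIsoShadowsStandard`      — card B, first lemma (profinite cancellation of S⁴-stabilisation).
* `shadows_of_stablyIso`          — card B, the S⁴-half of the crux from the first lemma (PROVED, logic).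
-/

namespace Summit.SmoothPoincare4.SmoothPoincare4.Cruxes.ShadowsStandard.Ideator2

open Literature.Topology.FourManifolds Subgroup

/-- The surface group of genus `3 + 3m`. -/
abbrev S (m : ℕ) : Type := SurfaceGroup (3 + 3 * m)

/-- The standard kernel triple of `S⁴` at genus `3 + 3m`. -/
noncomputable abbrev N (m : ℕ) : TrisectionKernels (3 + 3 * m) := s4Kernels.stabilizeIter m

/-- Level-`M` shadow of `K` is standard. -/
def StandardShadowAt (m : ℕ) (K : TrisectionKernels (3 + 3 * m)) (M : Subgroup (S m)) : Prop :=
  ∃ ψ : S m ≃* S m, ∀ i : Fin 3, (N m i ⊔ M).map ψ.toMonoidHom = K i ⊔ M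

/-- Verbatim body of the crux `CongruenceShadows.ShadowsStandard`. -/
def ShadowsStandardSig : Prop :=
  ∀ (m : ℕ) (K : TrisectionKernels (3 + 3 * m)),
    IsGroupTrisection (3 + 3 * m) (m + 1) (PUnit : Type) K →
    ∀ M : Subgroup (S m), M.Characteristic → M.FiniteIndex → StandardShadowAt m K M

/-! ## Card A — first lemma: one-sided (from inside `H₀`) finite standardness -/

/-- **Card A, first lemma.** For every `(3+3m, m+1)` group trisection `K` of `{1}` and every
characteristic finite-index `M ≤ S`, some automorphism of `S` carries `N₀ ↦ K₀`,
`N₁N₀ ↦ K₁K₀` and `N₂N₀M ↦ K₂K₀M`: seen from inside the first handlebody (i.e. in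
`π₁H₀ = S/K₀ ≅ F_{3k}`) and modulo `M`, the other two kernels are simultaneously standard.
Engines: WaldhausenPairs (slot normalisation), Borovik–Lubotzky–Myasnikov's finitary
Andrews–Curtis theorem in the finite group `F_k/W` on the `2k`-tuple of "tails", Luft's
surjection `MCG(H₀,*) ↠ Aut F_{3k}`. -/
def OneSidedShadowStandard : Prop :=
  ∀ (m : ℕ) (K : TrisectionKernels (3 + 3 * m)),
    IsGroupTrisection (3 + 3 * m) (m + 1) (PUnit : Type) K →
    ∀ M : Subgroup (S m), M.Characteristic → M.FiniteIndex →
      ∃ ψ : S m ≃* S m,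
        (N m 0).map ψ.toMonoidHom = K 0 ∧
        (N m 1 ⊔ N m 0).map ψ.toMonoidHom = K 1 ⊔ K 0 ∧
        (N m 2 ⊔ N m 0 ⊔ M).map ψ.toMonoidHom = K 2 ⊔ K 0 ⊔ M

/-- **Card A, strong form** (slot 1 fixed on the nose; needs in addition the Goeritz
realisation `MCG(#ᵏS¹×S², Σ_{3k}) ↠ Stab_{Aut F_{3k}}(⟪tails⟫)`). -/
def OneSidedShadowStandardStrong : Prop :=
  ∀ (m : ℕ) (K : TrisectionKernels (3 + 3 * m)),
    IsGroupTrisection (3 + 3 * m) (m + 1) (PUnit : Type) K →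
    ∀ M : Subgroup (S m), M.Characteristic → M.FiniteIndex →
      ∃ ψ : S m ≃* S m,
        (N m 0).map ψ.toMonoidHom = K 0 ∧
        (N m 1).map ψ.toMonoidHom = K 1 ∧
        (N m 2 ⊔ N m 0 ⊔ M).map ψ.toMonoidHom = K 2 ⊔ K 0 ⊔ M

/-! ## Card A — the residue lemma (proved) -/

/-- **Residue lemma, one inclusion.** Let `N, A, B` be normal subgroups of `G` with
`B ≤ N ⊔ A`, `N ⊓ B ≤ A`, and suppose the image of `N` in `(N ⊔ A)/A` (which is all of it) has
trivial centre, phrased element-wise: an `x ∈ N` commuting with `N` modulo `A` lies in `A`.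
Then `B ≤ A`.  (Applied with `N = N̂₀`, `A = N̂₂`, `B = K̂₂` in the profinite completion, where
`(N ⊔ A)/A ≅ ker(F̂_g ↠ F̂_k)` is a non-abelian free profinite group, hence centreless.) -/
theorem residue_le_of_center_trivial {G : Type*} [Group G] (N A B : Subgroup G)
    [N.Normal] [A.Normal] [B.Normal]
    (hB : B ≤ N ⊔ A) (hNB : N ⊓ B ≤ A)
    (hZ : ∀ x ∈ N, (∀ y ∈ N, y * x * y⁻¹ * x⁻¹ ∈ A) → x ∈ A) :
    B ≤ A := by
  intro b hb
  obtain ⟨n, hn, a, ha, rfl⟩ := (mem_sup_of_normal_left (s := N) (t := A)).1 (hB hb)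
  have hnA : n ∈ A := by
    refine hZ n hn fun y hy => ?_
    -- c := y (n a) y⁻¹ (n a)⁻¹ ∈ N ⊓ B ≤ A
    have hc : y * (n * a) * y⁻¹ * (n * a)⁻¹ ∈ A := by
      apply hNB
      refine ⟨?_, ?_⟩
      · -- membership in N: y ∈ N and (n a) y⁻¹ (n a)⁻¹ ∈ N
        have h1 : (n * a) * y⁻¹ * (n * a)⁻¹ ∈ N :=
          Normal.conj_mem inferInstance y⁻¹ (N.inv_mem hy) (n * a)
        have := N.mul_mem hy h1
        simpa [mul_assoc] using this
      · -- membership in B: y (n a) y⁻¹ ∈ B and (n a)⁻¹ ∈ B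
        have h1 : y * (n * a) * y⁻¹ ∈ B := Normal.conj_mem inferInstance (n * a) hb y
        exact B.mul_mem h1 (B.inv_mem hb)
    -- d := n (y a y⁻¹ a⁻¹) n⁻¹ ∈ A
    have hd : n * (y * a * y⁻¹ * a⁻¹) * n⁻¹ ∈ A := by
      have h1 : y * a * y⁻¹ ∈ A := Normal.conj_mem inferInstance a ha y
      have h2 : y * a * y⁻¹ * a⁻¹ ∈ A := A.mul_mem h1 (A.inv_mem ha)
      exact Normal.conj_mem inferInstance _ h2 n
    -- y n y⁻¹ n⁻¹ = c * d⁻¹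
    have key : y * n * y⁻¹ * n⁻¹ =
        (y * (n * a) * y⁻¹ * (n * a)⁻¹) * (n * (y * a * y⁻¹ * a⁻¹) * n⁻¹)⁻¹ := by
      group
    rw [key]
    exact A.mul_mem hc (A.inv_mem hd)
  exact A.mul_mem hnA ha

/-- **Residue lemma, symmetric form**: under the symmetric hypotheses, `A = B`. -/
theorem residue_eq_of_center_trivial {G : Type*} [Group G] (N A B : Subgroup G)
    [N.Normal] [A.Normal] [B.Normal]
    (hsup : N ⊔ A = N ⊔ B) (hinf : N ⊓ A = N ⊓ B)
    (hZA : ∀ x ∈ N, (∀ y ∈ N, y * x * y⁻¹ * x⁻¹ ∈ A) → x ∈ A)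
    (hZB : ∀ x ∈ N, (∀ y ∈ N, y * x * y⁻¹ * x⁻¹ ∈ B) → x ∈ B) :
    A = B := by
  apply le_antisymm
  · exact residue_le_of_center_trivial N B A (hsup ▸ le_sup_right) (hinf ▸ inf_le_right) hZB
  · exact residue_le_of_center_trivial N A B (hsup.symm ▸ le_sup_right) (hinf.symm ▸ inf_le_right) hZA

/-! ## Card A — the transferred crux C⁺ (level-wise form, statement only)

After the one-sided normalisation (slots `0,1` standard, `K₂N₀M = N₂N₀M` for all `M`), the crux
is equivalent (compactness + the residue lemma in `Ŝ`, using that closed normal subgroups of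
infinite index of a free profinite group of rank ≥ 2 are centreless) to: the double intersections
`N₀M ∩ K₂M` and `N₀M ∩ N₂M` are related by the Goeritz group `Stab N₀ ∩ Stab N₁`, coherently in
`M`.  The level-wise statement below records its shape; the coherent (profinite) version is the
one the card needs. -/

/-- Level-wise double-intersection rigidity (shape of C⁺; see the module docstring). -/
def LevelIntersectionRigidity : Prop :=
  ∀ (m : ℕ) (K : TrisectionKernels (3 + 3 * m)),
    IsGroupTrisection (3 + 3 * m) (m + 1) (PUnit : Type) K →
    K 0 = N m 0 → K 1 = N m 1 →
    (∀ M : Subgroup (S m), M.Characteristic → M.FiniteIndex →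
        K 2 ⊔ N m 0 ⊔ M = N m 2 ⊔ N m 0 ⊔ M) →
    ∀ M : Subgroup (S m), M.Characteristic → M.FiniteIndex →
      ∃ ψ : S m ≃* S m,
        (N m 0).map ψ.toMonoidHom = N m 0 ∧ (N m 1).map ψ.toMonoidHom = N m 1 ∧
        (N m 2 ⊔ N m 0 ⊔ M).map ψ.toMonoidHom = N m 2 ⊔ N m 0 ⊔ M ∧
        ((N m 0 ⊔ M) ⊓ (N m 2 ⊔ M)).map ψ.toMonoidHom = (N m 0 ⊔ M) ⊓ (K 2 ⊔ M)

/-! ## Card B — first lemma: finite shadows cancel `S⁴`-stabilisation -/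

/-- **Card B, first lemma (profinite Witt cancellation of `T_{S⁴}`-summands).** If a
`(3+3m, m+1)` group trisection `K` of `{1}` becomes isomorphic to the standard one after `n`
algebraic stabilisations OF BOTH, then every characteristic finite shadow of `K` is already
standard at its own genus.  (For `K` coming from `S⁴` the hypothesis always holds, by Gay–Kirby
Thm 11 — tree fact `stablyIso_groupGKTrisectionOf_of_diffeomorphic` — so this is exactly the
`S⁴`-half of the crux; the exotic half needs the `S² × S²`-summand analogue plus Wall + `Θ₄ = 0`.) -/
def StablyIsoShadowsStandard : Prop :=
  ∀ (m n : ℕ) (K : TrisectionKernels (3 + 3 * m)),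
    IsGroupTrisection (3 + 3 * m) (m + 1) (PUnit : Type) K →
    TrisectionKernels.Iso (K.stabilizeIter n) ((N m).stabilizeIter n) →
    ∀ M : Subgroup (S m), M.Characteristic → M.FiniteIndex → StandardShadowAt m K M

/-- From card B's first lemma: every trisection of `{1}` that is stably isomorphic (same number of
stabilisations on both sides) to the standard one has standard shadows — pure logic, recorded to
fix the shape of the `S⁴`-half. -/
theorem shadows_of_stablyIso (h : StablyIsoShadowsStandard) (m : ℕ)
    (K : TrisectionKernels (3 + 3 * m))
    (hK : IsGroupTrisection (3 + 3 * m) (m + 1) (PUnit : Type) K)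
    (hst : ∃ n, TrisectionKernels.Iso (K.stabilizeIter n) ((N m).stabilizeIter n))
    (M : Subgroup (S m)) (hM : M.Characteristic) (hF : M.FiniteIndex) :
    StandardShadowAt m K M := by
  obtain ⟨n, hn⟩ := hst
  exact h m n K hK hn M hM hF

/-! ## Card C — semisimple levels are Venn diagrams

At the semisimple level `M_T^{epi} = ⋂ {ker φ | φ : S ↠ T}` (`T` finite simple; `S/M_T^{epi} ≅ T^Ω`,
`Ω = Epi(S,T)/Aut T`) the shadow of `K` is the triple of subsets `Eᵢ = {φ̄ | φ(Kᵢ) = 1} ⊆ Ω`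
("epimorphisms extending over the handlebody `Hᵢ`"), whose Venn cells against `(E₀, E₁)` have
sizes forced by the trisection axioms; Dunfield–Thurston monodromy `Alt` on the class-`0` part
of `Ω` then makes all such configurations equivalent.  Typed: the level, the asymptotic statement
(a theorem from DT Thm 7.4 + WaldhausenPairs), and the all-genus statement (⇐ DT from genus 3). -/

/-- The semisimple (epi-)level of a finite group `T`: the intersection of the kernels of all
EPImorphisms `S ↠ T` (characteristic, finite index; for `T` simple the quotient is `T^Ω`). -/
def epiLevel (m : ℕ) (T : Type) [Group T] : Subgroup (S m) :=
  ⨅ φ : {φ : S m →* T // Function.Surjective φ}, (φ : S m →* T).ker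

/-- **Card C, asymptotic form** (claimed PROVABLE NOW from Dunfield–Thurston 2006 Thm 7.4 +
WaldhausenPairs + Venn-cell counting): for every finite simple `T`, from some genus on, every
balanced trisection of `{1}` has standard shadow at the semisimple level of `T`. -/
def SemisimpleShadowsAsymptotic : Prop :=
  ∀ (T : Type) [Group T] [Finite T], IsSimpleGroup T →
    ∃ m₀ : ℕ, ∀ m ≥ m₀, ∀ (K : TrisectionKernels (3 + 3 * m)),
      IsGroupTrisection (3 + 3 * m) (m + 1) (PUnit : Type) K →
      StandardShadowAt m K (epiLevel m T)

/-- **Card C, first lemma / transferred crux on the semisimple stratum**: standard shadows at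
every semisimple level at EVERY genus `3 + 3m` (⇐ Dunfield–Thurston's "full alternating
monodromy from genus 3" on the class-0 epimorphisms, by the same Venn-cell counting). -/
def SemisimpleShadowsStandard : Prop :=
  ∀ (T : Type) [Group T] [Finite T], IsSimpleGroup T →
    ∀ (m : ℕ) (K : TrisectionKernels (3 + 3 * m)),
      IsGroupTrisection (3 + 3 * m) (m + 1) (PUnit : Type) K →
      StandardShadowAt m K (epiLevel m T)

/-- The crux implies card C's statement outright once `epiLevel` is known characteristic and of
finite index (both routine: automorphisms permute epimorphisms; finitely many homs to a finite
group) — recorded as the implication with those two facts as hypotheses. -/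
theorem semisimpleShadowsStandard_of_shadowsStandard (h : ShadowsStandardSig)
    (hchar : ∀ (m : ℕ) (T : Type) [Group T] [Finite T], (epiLevel m T).Characteristic)
    (hfin : ∀ (m : ℕ) (T : Type) [Group T] [Finite T], (epiLevel m T).FiniteIndex) :
    SemisimpleShadowsStandard := by
  intro T _ _ _ m K hK
  exact h m K hK (epiLevel m T) (hchar m T) (hfin m T)

end Summit.SmoothPoincare4.SmoothPoincare4.Cruxes.ShadowsStandard.Ideator2
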